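import Literature.AlgebraicGeometry.AbelianSchemes.AbelianSchemeQuotientPolarizationPullbackDesc
import Literature.AlgebraicGeometry.AbelianSchemes.AbelianSchemeQuotientHatIsDualIsogeny
import Literature.AlgebraicGeometry.AbelianSchemes.FibreHomPointsOfFibrePoints
import HarnessLib

/-!
# `ψ̂ ≫ ψ^∨ = [n]_Â` and «`λ_B` is onto on geometric fibre points» for the quotient `ψ : A → B = A/K`

Layer `Literature/AlgebraicGeometry/AbelianSchemes`, namespace `Literature.AlgebraicGeometry.AbelianSchemes.AbelianSchemeOver`.
THEOREMS ONLY (no definition, no named fact, no instance, no `sorry`).  Cell `hodgecm-mathlib` (D-0151), Hecke-link socket (QT),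
two named inputs of the `htype` adapter ★ `Polarization.hasType_polarizationDesc_of_count` (B-p03 (g15) 00:29:04Z / 00:30:45Z):

* §1 **`quotientMk_hat_comp_dualIsogenyOver_quotientMk_eq_mulN`** — `ψ̂ ≫ ψ^∨ = [n]_Â` for the two-step descent
  `ψ : A → A/K`, `ψ̂ : Â → Â/K′` (`K ⊆ A[n]`): `ψ̂ = π_n^∨` (★ `quotientMk_eq_dualIsogenyOver_mulNDesc`, [MumfordAV1970] §15 Thm. 1),
  `π_n^∨ ≫ ψ^∨ = (ψ ≫ π_n)^∨` (★ `dualIsogenyOver_comp`), `ψ ≫ π_n = [n]_A` (★ `quotientMk_comp_mulNDesc`), `[n]_A^∨ = [n]_Â`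
  (★ `dualIsogenyOver_mulN`);
* §2 **`polarizationDesc_ontoFibres`** — if `λ` is onto on geometric fibre points over `s` then so is the descended `λ_B`
  (`ψ ≫ λ_B = λ ≫ ψ̂`, ★ `quotientMk_comp_polarizationDesc`, and `ψ̂` onto on geometric fibres, ★ `quotientBy_ontoFibres`), and
  **`surjective_map_fibreHom_of_lam_eq_polarizationDesc`** — the same for any polarisation structure `polB` of `(A/K, D_B)` with
  `polB.lam = λ_B`, in the `AlgPoints.map (fibreHom polB.lam s)` currency (= the `hlamB` binder of ★ `hasType_polarizationDesc_of_count`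
  VERBATIM), via ★ `surjective_map_fibreHom_of_forall_fibrePoints`.

HC_CM is proved only modulo the 7 printed citations until rung 0 closes; nothing here is about HC.

## References
* [MumfordAV1970] D. Mumford, *Abelian Varieties* (1970), §15 Thm. 1 (p. 143), §7 Thm. 4 (p. 72), §23 (p. 231), §8 (iv) (p. 75).
* [MumfordFogartyKirwan1994] D. Mumford, J. Fogarty, F. Kirwan, *Geometric Invariant Theory*, 3rd ed. (1994), Ch. 6 §2 Definition 6.3
  (p. 120); Ch. 7 §3 (p. 139).
-/

noncomputable section

universe u

open CategoryTheory CategoryTheory.Limits AlgebraicGeometry MonoidalCategory CartesianMonoidalCategory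
open scoped MonObj

namespace Literature.AlgebraicGeometry.AbelianSchemes

namespace AbelianSchemeOver

open Literature.AlgebraicGeometry.RelativeSpec Literature.AlgebraicGeometry.AbelianVarieties
  Literature.AlgebraicGeometry.Motives Literature.AlgebraicGeometry.Modules

variable {S : Scheme.{u}} [IsReduced S] [IsLocallyNoetherian S] (A : AbelianSchemeOver S)
  {Y : Scheme.{u}} (u : S ⟶ Y) (K : Subgroup A.Sections) [IsCommMonObj A.X] {n : ℕ}
  (hK : ∀ σ : K, (σ : A.Sections) ^ n = 1)
  [Finite K] [Y.IsSeparated] [IsSeparated (A.X.hom ≫ u)] [S.IsSeparated]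
  (hcov : ∀ x : A.left, ∃ O : (A.translationActionOver u K).StableAffineOpens, x ∈ O.1)
  [LocallyOfFiniteType (A.X.hom ≫ u)] [IsLocallyNoetherian Y]
  (hG : ∃ _ : GrpObj (A.quotientOver u K), IsMonHom (A.quotientMk u K hcov))
  (hsm : Smooth (A.quotientOver u K).hom) (hgc : GeometricallyConnected (A.quotientOver u K).hom)
  (D : A.DualPair) [IsAffine Y]
  (hfree : ∀ (Ω : Type u) [Field Ω] [IsAlgClosed Ω] (x : Spec (.of Ω) ⟶ A.left) (σ : K), σ ≠ 1 →
    x ≫ (A.translation (σ : A.Sections)).left ≠ x)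
  (K' : Subgroup D.hat.Sections) [Finite K'] [IsSeparated (D.hat.X.hom ≫ u)]
  (hcov' : ∀ x : D.hat.left, ∃ O : (D.hat.translationActionOver u K').StableAffineOpens, x ∈ O.1)
  [LocallyOfFiniteType (D.hat.X.hom ≫ u)]
  (hG' : ∃ _ : GrpObj (D.hat.quotientOver u K'), IsMonHom (D.hat.quotientMk u K' hcov'))
  (hsm' : Smooth (D.hat.quotientOver u K').hom) (hgc' : GeometricallyConnected (D.hat.quotientOver u K').hom)
  (hfree' : ∀ (Ω : Type u) [Field Ω] [IsAlgClosed Ω] (x : Spec (.of Ω) ⟶ D.hat.left) (σ : K'), σ ≠ 1 →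
    x ≫ (D.hat.translation (σ : D.hat.Sections)).left ≠ x)
  (Φ : (prodTranslationActionOver (A.quotientBy u K hcov hG hsm hgc) D.hat u K' hcov').EquivariantStructure
    (A.poincarePullback u K hK hcov hG hsm hgc D hfree))
  (h4 : ∀ {T : Scheme.{u}} (f : T ⟶ S) (ℒ : (A.quotientBy u K hcov hG hsm hgc).RigidifiedLineBundle f),
    ℒ.FibrewisePicZero →
    ∃! g : {g : T ⟶ (D.hat.quotientBy u K' hcov' hG' hsm' hgc').X.left //
        g ≫ (D.hat.quotientBy u K' hcov' hG' hsm' hgc').X.hom = f},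
      Nonempty ((Scheme.Modules.pullback ((A.quotientBy u K hcov hG hsm hgc).baseChangeToProd
        (D.hat.quotientBy u K' hcov' hG' hsm' hgc') f g.1 g.2)).obj
          (A.poincareQuotRigid u K hK hcov hG hsm hgc D hfree K' hcov' hG' hsm' hgc' Φ) ≅ ℒ.L))

/-! ## §1 `ψ̂ ≫ ψ^∨ = [n]_Â` -/

include hfree' in
/-- **`ψ̂ ≫ ψ^∨ = [n]_Â`**: the quotient map `ψ̂ : Â → Â/K′ = B̂` followed by the dual homomorphism `ψ^∨ : B̂ → Â` of
`ψ : A → B = A/K` (dual taken with the descended Poincaré pair `D_B = dualPairOfQuotientRigidified …`) is multiplication by `n` on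
`Â` — `ψ̂ = π_n^∨`, `π_n^∨ ≫ ψ^∨ = (ψ ≫ π_n)^∨ = [n]_A^∨ = [n]_Â` (under the unit normalisation `hD` of `𝒫`, e.g. ★
`Polarization.nonempty_unitHatSlice_iso`). [cite: MumfordAV1970, §15 Thm. 1 (p. 143) and §7 Thm. 4 (p. 72)]
[cite: MumfordFogartyKirwan1994, Ch. 7 §3 (p. 139)] -/
theorem quotientMk_hat_comp_dualIsogenyOver_quotientMk_eq_mulN
    (hD : Nonempty ((Scheme.Modules.pullback (DualPair.unitHatSlice D)).obj D.P ≅ SheafOfModules.unit _)) :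
    letI : GrpObj (A.quotientOver u K) := (A.quotientBy u K hcov hG hsm hgc).grpObj
    letI : GrpObj (D.hat.quotientOver u K') := (D.hat.quotientBy u K' hcov' hG' hsm' hgc').grpObj
    D.hat.quotientMk u K' hcov' ≫
        @DualPair.dualIsogenyOver S A (A.quotientBy u K hcov hG hsm hgc) (A.quotientMk u K hcov)
          (A.isMonHom_quotientMk u K hcov hG hsm hgc) D
          (A.dualPairOfQuotientRigidified u K hK hcov hG hsm hgc D hfree K' hcov' hG' hsm' hgc' hfree' Φ h4) =
      D.hat.mulN n := by
  letI : GrpObj (A.quotientOver u K) := (A.quotientBy u K hcov hG hsm hgc).grpObj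
  letI : GrpObj (D.hat.quotientOver u K') := (D.hat.quotientBy u K' hcov' hG' hsm' hgc').grpObj
  haveI hψ := A.isMonHom_quotientMk u K hcov hG hsm hgc
  haveI hπ := A.isMonHom_mulNDesc u K hK hcov hG hsm hgc hfree
  haveI hAn := A.isMonHom_mulN n
  -- `ψ̂ = π_n^∨`
  have h1 : (D.hat.quotientMk u K' hcov' : D.hat.X ⟶ (D.hat.quotientBy u K' hcov' hG' hsm' hgc').X) =
      @DualPair.dualIsogenyOver S (A.quotientBy u K hcov hG hsm hgc) A (A.mulNDesc u K hK hcov) hπ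
        (A.dualPairOfQuotientRigidified u K hK hcov hG hsm hgc D hfree K' hcov' hG' hsm' hgc' hfree' Φ h4) D :=
    A.quotientMk_eq_dualIsogenyOver_mulNDesc u K hK hcov hG hsm hgc D hfree K' hcov' hG' hsm' hgc' hfree' Φ h4
  -- `π_n^∨ ≫ ψ^∨ = (ψ ≫ π_n)^∨`
  have h2 := (@DualPair.dualIsogenyOver_comp S A (A.quotientBy u K hcov hG hsm hgc) A (A.quotientMk u K hcov)
    (A.mulNDesc u K hK hcov) hψ hπ D
    (A.dualPairOfQuotientRigidified u K hK hcov hG hsm hgc D hfree K' hcov' hG' hsm' hgc' hfree' Φ h4) D).symm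
  refine ((eq_whisker h1 _).trans h2).trans ?_
  -- `(ψ ≫ π_n)^∨ = [n]_A^∨ = [n]_Â`
  exact (DualPair.dualIsogenyOver_congr (h₂ := hAn) _ _ (A.quotientMk_comp_mulNDesc u K hK hcov)).trans
    (DualPair.dualIsogenyOver_mulN _ hD n)

/-! ## §2 `λ_B` is onto on geometric fibre points when `λ` is -/

section Onto

variable (lam : A.X ⟶ D.hat.X)
  (hlam : ∀ σ : K, A.translation (σ : A.Sections) ≫ lam ≫ D.hat.quotientMk u K' hcov' = lam ≫ D.hat.quotientMk u K' hcov')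

omit [IsReduced S] [IsLocallyNoetherian S] [IsCommMonObj A.X] [IsAffine Y] in
/-- **`λ_B` IS ONTO ON GEOMETRIC FIBRE POINTS WHEN `λ` IS**: over a geometric point `s`, every `Ω`-point `y` of `B̂_s = (Â/K′)_s`
lifts along `ψ̂` to `ŷ ∈ Â(s)` (★ `quotientBy_ontoFibres`), `ŷ` lifts along `λ` to `x′ ∈ A(s)` (`hsurj`), and `x := x′ ≫ ψ`
satisfies `x ≫ λ_B = x′ ≫ λ ≫ ψ̂ = y` (★ `quotientMk_comp_polarizationDesc`). [cite: MumfordAV1970, §7 Thm. 4 (p. 72) and §23 (p. 231)]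
[cite: MumfordFogartyKirwan1994, Ch. 6 §2 Definition 6.3 (p. 120)] -/
theorem polarizationDesc_ontoFibres {Ω : Type u} [Field Ω] [IsAlgClosed Ω] (s : Spec (.of Ω) ⟶ S)
    (hsurj : ∀ y : D.hat.FibrePoints s, ∃ x : A.FibrePoints s, x ≫ lam = y)
    (y : (D.hat.quotientBy u K' hcov' hG' hsm' hgc').FibrePoints s) :
    ∃ x : (A.quotientBy u K hcov hG hsm hgc).FibrePoints s,
      x ≫ (A.polarizationDesc u K hcov D.hat K' hcov' lam hlam :
        (A.quotientBy u K hcov hG hsm hgc).X ⟶ (D.hat.quotientBy u K' hcov' hG' hsm' hgc').X) = y := by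
  obtain ⟨yh, hyh⟩ := D.hat.quotientBy_ontoFibres u K' hcov' hG' hsm' hgc' s y
  obtain ⟨x', hx'⟩ := hsurj yh
  refine ⟨x' ≫ (A.quotientMk u K hcov : A.X ⟶ (A.quotientBy u K hcov hG hsm hgc).X), ?_⟩
  -- `(x′ ≫ ψ) ≫ λ_B = x′ ≫ (λ ≫ ψ̂) = (x′ ≫ λ) ≫ ψ̂ = ŷ ≫ ψ̂ = y` (no `rw`: the quotient's two spellings defeat keyed matching)
  have key := A.quotientMk_comp_polarizationDesc u K hcov D.hat K' hcov' lam hlam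
  exact (Category.assoc _ _ _).trans ((whisker_eq x' key).trans ((Category.assoc _ _ _).symm.trans
    ((eq_whisker hx' _).trans hyh)))

end Onto

omit [IsReduced S] [IsLocallyNoetherian S] in
include hfree hfree' in
/-- **The `hlamB` binder of ★ `hasType_polarizationDesc_of_count` discharged**: for any polarisation structure `polB` of
`(A/K, D_B)` with `polB.lam = λ_B` (★ `exists_polarization_lam_eq_polarizationDesc`), if `λ` is onto on geometric fibre points
(the `hsurj` binder, ★ `exists_comp_lam_eq_baseChange_of_locallyOfFiniteType` for typed families) then `(polB.lam)_s` is
surjective on `Ω`-points at every geometric point `s` (§2 + ★ `surjective_map_fibreHom_of_forall_fibrePoints`).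
[cite: MumfordFogartyKirwan1994, Ch. 6 §2 Definition 6.3 (p. 120) and Ch. 7 §3 (p. 139)] [cite: MumfordAV1970, §23 (p. 231)] -/
theorem surjective_map_fibreHom_of_lam_eq_polarizationDesc (pol : A.Polarization D)
    (hlam : ∀ σ : K, A.translation (σ : A.Sections) ≫ pol.lam ≫ D.hat.quotientMk u K' hcov' =
      pol.lam ≫ D.hat.quotientMk u K' hcov')
    (polB : (A.quotientBy u K hcov hG hsm hgc).Polarization
      (A.dualPairOfQuotientRigidified u K hK hcov hG hsm hgc D hfree K' hcov' hG' hsm' hgc' hfree' Φ h4))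
    (hpolB : polB.lam = A.polarizationDesc u K hcov D.hat K' hcov' pol.lam hlam)
    (hsurj : ∀ ⦃Ω : Type u⦄ [Field Ω] [IsAlgClosed Ω] (s : Spec (.of Ω) ⟶ S) (y : D.hat.FibrePoints s),
      ∃ x : A.FibrePoints s, x ≫ pol.lam = y) :
    ∀ (Ω : Type u) [Field Ω] [IsAlgClosed Ω] (s : Spec (.of Ω) ⟶ S),
      haveI := polB.isMonHom
      Function.Surjective (AlgPoints.map (L := Ω) (fibreHom polB.lam s).hom.hom.hom) := by
  intro Ω _ _ s
  haveI := polB.isMonHom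
  refine surjective_map_fibreHom_of_forall_fibrePoints (A := A.quotientBy u K hcov hG hsm hgc) s polB.lam fun y => ?_
  obtain ⟨x, hx⟩ := A.polarizationDesc_ontoFibres u K hcov hG hsm hgc D K' hcov' hG' hsm' hgc' pol.lam hlam s (hsurj s) y
  exact ⟨x, by rw [hpolB]; exact hx⟩

end AbelianSchemeOver

end Literature.AlgebraicGeometry.AbelianSchemes

end
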